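import Mathlib
import HarnessLib
import Summits.KontsevichZagierPeriods.Zeta5Search.DougallZudilinForm
import Literature.Analysis.SpecialFunctions.SelbergIntegralBasic

/-!
# ζ(5) search — the case `k = 1` of Zudilin's integral theorem (Carlson sub-range) (cell `pub-zeta5`, ct-1 g26)

HONEST FRAMING: systematic search; no irrationality claim unless kernel-certified.  Identities of special functions;
nothing here is an irrationality result; no named fact of the tree is discharged: the typed
`Literature.NumberTheory.Irrationality.Zudilin2002.vwp_eq_integral_of_pos` quantifies over every `k ≥ 1`; this file proves
its INSTANCE `k = 1` on the sub-range `2(h₁+h₂) < 1+h₀`, `2h₃ < 1+h₀` of the typed hypotheses (eqs. (9)–(11) of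
[Zudilin, math/0206177]: `F₃` by Dougall, `J₁` by Euler's Beta integral).
* `sorokinIntegral_one` — the typed `J₁(a₀; a₁ | b₁)` is the one-variable integral `∫_{[0,1]} t^{a₁−1}(1−t)^{b₁−a₁−1}/(1−t)^{a₀}`;
* `sorokinIntegral_one_eq` — `J₁(a₀; a₁ | b₁) = Γ(a₁)Γ(b₁−a₁−a₀)/Γ(b₁−a₀)` for `a₁ > 0`, `b₁−a₁−a₀ > 0` (eq. (11));
* `vwp_eq_integral_one_carlson` — the `k = 1` instance of the typed identity on the Carlson sub-range.
Theorems only (no new definitions).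
-/

noncomputable section

namespace Summit.KontsevichZagierPeriods.Zeta5Search.ZudilinVWPBaseCase

open MeasureTheory Set Finset
open Literature.NumberTheory.Irrationality.Zudilin2002 (vwpSeries nestedQ sorokinIntegrand sorokinIntegral)
open Summit.KontsevichZagierPeriods.Zeta5Search.DougallZudilinForm (vwpSeries_three_eq)

/-- For one variable the typed Sorokin integrand is `t^{a₁−1}(1−t)^{b₁−a₁−1}/(1−t)^{a₀}` at `t = x 0`. -/
theorem sorokinIntegrand_one (a₀ : ℝ) (a b : ℕ → ℝ) (x : Fin 1 → ℝ) :
    sorokinIntegrand 1 a₀ a b x = (x 0) ^ (a 0 - 1) * (1 - x 0) ^ (b 0 - a 0 - 1) / (1 - x 0) ^ a₀ := by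
  unfold sorokinIntegrand
  simp [nestedQ, List.ofFn_succ]

/-- **`J₁` as a one-variable integral**: `J₁(a₀; a₁ | b₁) = ∫_{[0,1]} t^{a₁−1}(1−t)^{b₁−a₁−1}/(1−t)^{a₀} dt`
(transfer along `MeasurableEquiv.funUnique (Fin 1) ℝ`). -/
theorem sorokinIntegral_one (a₀ : ℝ) (a b : ℕ → ℝ) :
    sorokinIntegral 1 a₀ a b = ∫ t in Icc (0 : ℝ) 1, t ^ (a 0 - 1) * (1 - t) ^ (b 0 - a 0 - 1) / (1 - t) ^ a₀ := by
  unfold sorokinIntegral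
  simp_rw [sorokinIntegrand_one]
  have hpre : Set.pi Set.univ (fun _ : Fin 1 => Icc (0 : ℝ) 1) = MeasurableEquiv.funUnique (Fin 1) ℝ ⁻¹' Icc 0 1 := by
    ext x
    simp [MeasurableEquiv.funUnique, Fin.default_eq_zero, Pi.le_def, Fin.forall_fin_one]
  rw [hpre]
  exact (volume_preserving_funUnique (Fin 1) ℝ).setIntegral_preimage_emb
    (MeasurableEquiv.funUnique (Fin 1) ℝ).measurableEmbedding
    (fun t : ℝ => t ^ (a 0 - 1) * (1 - t) ^ (b 0 - a 0 - 1) / (1 - t) ^ a₀) (Icc 0 1)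

/-- **Eq. (11) of Zudilin's note**: `J₁(a₀; a₁ | b₁) = Γ(a₁)Γ(b₁−a₀−a₁)/Γ(b₁−a₀)` for `a₁ > 0` and `b₁−a₀−a₁ > 0`
(Euler's Beta integral). -/
theorem sorokinIntegral_one_eq (a₀ : ℝ) (a b : ℕ → ℝ) (ha : 0 < a 0) (hb : 0 < b 0 - a 0 - a₀) :
    sorokinIntegral 1 a₀ a b = Real.Gamma (a 0) * Real.Gamma (b 0 - a 0 - a₀) / Real.Gamma (b 0 - a₀) := by
  rw [sorokinIntegral_one, integral_Icc_eq_integral_Ioo]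
  have hcongr : EqOn (fun t : ℝ => t ^ (a 0 - 1) * (1 - t) ^ (b 0 - a 0 - 1) / (1 - t) ^ a₀)
      (fun t : ℝ => t ^ (a 0 - 1) * (1 - t) ^ ((b 0 - a 0 - a₀) - 1)) (Ioo (0 : ℝ) 1) := by
    intro t ht
    have h1t : 0 < 1 - t := by linarith [ht.2]
    simp only
    rw [mul_div_assoc, ← Real.rpow_sub h1t]
    ring_nf
  rw [setIntegral_congr_fun measurableSet_Ioo hcongr,
    (Literature.Analysis.SpecialFunctions.Selberg.integrableOn_Ioo_rpow_mul_one_sub_rpow_and_integral_eq ha hb).2]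
  ring_nf

/-- **The case `k = 1` of the typed `vwp_eq_integral_of_pos`, Carlson sub-range**: for `h : ℕ → ℝ` with
`h 0, h 1, h 2, h 3 > 0`, `2(h 1 + h 2) < 1 + h 0` and `2·h 3 < 1 + h 0` (which imply the typed hypotheses (5)–(6) at `k = 1`),
`Γ(1+h₀−h₁−h₂)Γ(1+h₀−h₂−h₃)/(Γ(h₁)Γ(h₃)) · F₃(h₀;h₁,h₂,h₃) = J₁(h₁; h₂ | 1+h₀−h₃)` — the instance `k = 1` of the typed
statement reads `(∏_{j ∈ Icc 1 2} Γ(1+h 0−h j−h (j+1)))/(Γ(h 1)Γ(h 3)) · vwpSeries 3 h = sorokinIntegral 1 (h 1) (h (·+2)) (1+h 0−h (·+3))`.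
Eqs. (9)–(11) of Zudilin's note. -/
theorem vwp_eq_integral_one_carlson (h : ℕ → ℝ) (hh₀ : 0 < h 0) (hh₁ : 0 < h 1) (hh₂ : 0 < h 2) (hh₃ : 0 < h 3)
    (hsum : 2 * (h 1 + h 2) < 1 + h 0) (h3lt : 2 * h 3 < 1 + h 0) :
    (∏ j ∈ Finset.Icc 1 2, Real.Gamma (1 + h 0 - h j - h (j + 1))) / (Real.Gamma (h 1) * Real.Gamma (h 3)) *
        vwpSeries 3 h =
      sorokinIntegral 1 (h 1) (fun i => h (i + 2)) (fun i => 1 + h 0 - h (i + 3)) := by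
  rw [vwpSeries_three_eq h hh₀ hh₁ hh₂ hh₃ hsum h3lt,
    sorokinIntegral_one_eq (h 1) (fun i => h (i + 2)) (fun i => 1 + h 0 - h (i + 3)) (by simpa using hh₂)
      (by simp; linarith)]
  have hI : Finset.Icc 1 2 = {1, 2} := by decide
  rw [hI, Finset.prod_insert (by decide), Finset.prod_singleton]
  have hΓ1 : Real.Gamma (h 1) ≠ 0 := (Real.Gamma_pos_of_pos hh₁).ne'
  have hΓ3 : Real.Gamma (h 3) ≠ 0 := (Real.Gamma_pos_of_pos hh₃).ne'
  have hΓ12 : Real.Gamma (h 0 - h 1 - h 2 + 1) ≠ 0 := (Real.Gamma_pos_of_pos (by linarith)).ne'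
  have hΓ13 : Real.Gamma (h 0 - h 1 - h 3 + 1) ≠ 0 := (Real.Gamma_pos_of_pos (by linarith)).ne'
  have hΓ23 : Real.Gamma (h 0 - h 2 - h 3 + 1) ≠ 0 := (Real.Gamma_pos_of_pos (by linarith)).ne'
  rw [show (1 + h 0 - h 1 - h (1 + 1)) = h 0 - h 1 - h 2 + 1 by norm_num; ring,
    show (1 + h 0 - h 2 - h (2 + 1)) = h 0 - h 2 - h 3 + 1 by norm_num; ring,
    show (1 + h 0 - h (0 + 3) - h (0 + 2) - h 1) = h 0 - h 1 - h 2 - h 3 + 1 by norm_num; ring,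
    show (1 + h 0 - h (0 + 3) - h 1) = h 0 - h 1 - h 3 + 1 by norm_num; ring]
  field_simp

end Summit.KontsevichZagierPeriods.Zeta5Search.ZudilinVWPBaseCase

end
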